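import Literature.Geometry.Riemannian.PParabolicNhdSubsetConventionalAux
import Literature.Geometry.Riemannian.CurvatureFamilyBounds
import Literature.Geometry.Riemannian.RicciFlowMetricLimit
import HarnessLib

/-!
# `P*`-parabolic neighbourhoods lie in conventional parabolic neighbourhoods under a local
# two-sided Ricci bound (Bamler 2020a, Cor. 9.6 (b); arXiv v1 Cor. 34 (b)), forward case

R. Bamler, *Entropy and heat kernel bounds on a Ricci flow background*, arXiv:2008.07093 (2020a),
§9.1, Cor. 9.6: *"Consider the parabolic neighborhood `P := P(x₀, t₀; A′ r, −T⁻ r², T⁺ r²)` and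
assume that `|Ric| ≤ K r⁻²` on `P`. (b) If `A′ ≥ A̲′(K, A, T⁻, T⁺)`, then
`P*(x₀, t₀; A r, −T⁻ r², T⁺ r²) ⊂ P`."* In §9.2 the general case is reduced to `T⁻ = 0` ("we may
assume that `T⁻ = 0`"), and the forward case is proved by a bootstrap over a maximal time `T*`
((9.12)–(9.13)), closed "by continuity".

This file proves the FORWARD CASE `T⁻ = 0` for the metric flow `𝒳 = ricciFlowMetricFlow hh hR _ hflow`
of a Ricci flow on a closed manifold, `exists_edist_lt_of_mem_pParabolicNhd_of_ricci_bound`: for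
`m ≥ 3`, `K, A ≥ 0`, `T⁺ > 0` there is `A′ = A′(m, K, A, T⁺)` such that whenever `|Ric_s| ≤ (K/r²) g_s`
on `B_{t₀}(x₀, A′ r) × [t₀, t₀ + T⁺ r²]` (`a < t₀`, `t₀ + T⁺ r² ≤ T`), every
`(x, t) ∈ P*(x₀, t₀; A r, 0, T⁺ r²)` has `d_{t₀}(x₀, x) < A′ r`.

The proof REPLACES the source's continuity bootstrap by a discrete bootstrap along `H_m`-centres
(the ingredients are in `PParabolicNhdSubsetConventionalAux.lean`). Fix `(x, t)` of `P*`-level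
`d^{t₀}_{W₁}(δ_{x₀}, ν_{x,t;t₀}) < A r` and call `(z, s)`, `s ∈ [t₀, t]`, ROUGH if
`d_{t₀}(x₀, z) < (A′/2) r`. Claim: every `H_m`-centre of `(x, t)` at every time `s ∈ [t₀, t]` is
rough. At `s = t₀`: `d_{t₀}(x₀, z) = d_{W₁}(δ_{x₀}, δ_z) ≤ A r + √(H_m (t − t₀))`. Step `s′ ↦ s`,
`s − s′ ≤ δ`, `δ = min(r², 1/K_g)` with `K_g` a (qualitative) global bound `|Ric| ≤ K_g` of the
compact smooth flow (`IsContMDiffFamilyOn.exists_curvatureBoundedBy_of_isCompact`,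
`CurvatureBoundedBy.abs_ricci_le`): an `H_m`-centre `z′` of `(x, t)` at `s′` is rough by induction,
hence sharply localised by Prop. 9.5 (`exists_wassersteinW1_condKernel_dirac_le_of_rough`); the
`H_m`-centres `w` of `(z, s)` at `s′` satisfy `d_{s′}(z, w) ≤ C₀ √(s − s′) ≤ C₀ r` by Prop. 9.5 at
the global curvature scale (`exists_edist_hCenter_le_of_global_ricci_bound`, `K_g δ ≤ 1`); and the
bootstrap step `edist_lt_of_isHCenter_of_isHCenter` (levels of `H_m`-centres, `W₁`-triangle
inequalities, backward distance distortion around `z′`) gives that `z` is rough, for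
`A′ = 2(A + √(H_m T⁺) + C + e^{K T⁺}(2√(H_m T⁺) + √H_m + C₀)) + 2 e^{K T⁺} √T⁺ + 1`. After
`⌈(t − t₀)/δ⌉` steps, `x` itself — an `H_m`-centre of `(x, t)` at time `t` — is rough:
`d_{t₀}(x₀, x) < (A′/2) r`. The constant `K_g` only enters through the number of steps.

Everything is proved; no definitions, no named facts. What is NOT here: the backward case
`T⁻ > 0` (reduced to this one in the source) and part (a) (`ParabolicNhdComparison.lean`).

## References

* R. H. Bamler, *Entropy and heat kernel bounds on a Ricci flow background*, arXiv:2008.07093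
  (2020), §9.1, Def. 9.1, Prop. 9.5, Cor. 9.6 (b) (arXiv v1: Prop. 33, Cor. 34 (b)); §9.2, proof
  of Cor. 9.6, (9.12)–(9.13). [Bamler2020Entropy]
* R. H. Bamler, *Compactness theory of the space of super Ricci flows*, Invent. Math. 233 (2023),
  §3.4 (`H`-centres), §3.5 (`P*`-parabolic neighbourhoods). [Bamler2023]
-/

noncomputable section

open Set Filter Function MeasureTheory Measure
open scoped Manifold ContDiff Topology ENNReal NNReal

namespace Literature.Geometry.Riemannian

open Lorentzian Lorentzian.PseudoRiemannianMetric MetricFlow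

/-- **Bamler 2020a, Cor. 9.6 (b) (arXiv v1 Cor. 34 (b)), forward case `T⁻ = 0`:
`P*(x₀, t₀; A r, 0, T⁺ r²) ⊂ P(x₀, t₀; A′ r, 0, T⁺ r²)` under `|Ric| ≤ K r⁻²` on the conventional
neighbourhood.** For `m ≥ 3`, `K, A ≥ 0` and `T⁺ > 0` there is `A′ = A′(m, K, A, T⁺) > 0` such
that: for every Ricci flow `hflow = (h, cov)` on `[a, T]` of a smooth family of Riemannian metrics
on a closed connected `m`-manifold, metric flow `𝒳 = ricciFlowMetricFlow hh hR _ hflow`, all `x₀`,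
`t₀ ∈ (a, T]`, `r > 0` with `t₀ + T⁺ r² ≤ T`, if `|Ric_s(y)| ≤ (K/r²) g_s(y)` for all
`s ∈ [t₀, t₀ + T⁺ r²]` and `y ∈ B_{t₀}(x₀, A′ r)`, then every point `(x, t)`, `t ∈ [a, T]`, of
`𝒳.pParabolicNhd (x₀, t₀) (A r) 0 (T⁺ r²)` (i.e. `t ∈ [t₀, t₀ + T⁺ r²]` and
`d^{t₀}_{W₁}(ν_{x₀,t₀;t₀}, ν_{x,t;t₀}) < A r`) satisfies `d_{t₀}(x₀, x) < A′ r`. The proof is the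
discrete `H_m`-centre bootstrap described in the module docstring (the source closes a
maximal-time bootstrap by continuity instead); the qualitative global Ricci bound of the compact
smooth flow is obtained from `IsContMDiffFamilyOn.exists_curvatureBoundedBy_of_isCompact` and
does not enter `A′`. [cite: Bamler2020Entropy, §9.1, Cor. 9.6 (b) (arXiv v1 Cor. 34 (b)); §9.2, proof] -/
theorem exists_edist_lt_of_mem_pParabolicNhd_of_ricci_bound (m : ℕ) (hm : 3 ≤ m) {K A Tp : ℝ}
    (hK : 0 ≤ K) (hA : 0 ≤ A) (hTp : 0 < Tp) :
    ∃ A' : ℝ, 0 < A' ∧ ∀ {M : Type*} [TopologicalSpace M]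
      [ChartedSpace (EuclideanSpace ℝ (Fin m)) M]
      [IsManifold 𝓘(ℝ, EuclideanSpace ℝ (Fin m)) ∞ M] [T2Space M] [CompactSpace M]
      [SecondCountableTopology M] [MeasurableSpace M] [BorelSpace M] [ConnectedSpace M]
      {h : ℝ → PseudoRiemannianMetric 𝓘(ℝ, EuclideanSpace ℝ (Fin m)) ∞ (EuclideanSpace ℝ (Fin m))
        (TangentSpace 𝓘(ℝ, EuclideanSpace ℝ (Fin m)) : M → Type _)}
      {cov : ℝ → CovariantDerivative 𝓘(ℝ, EuclideanSpace ℝ (Fin m)) (EuclideanSpace ℝ (Fin m))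
        (TangentSpace 𝓘(ℝ, EuclideanSpace ℝ (Fin m)) : M → Type _)}
      {a T : ℝ} (hflow : IsRicciFlow h cov (Icc a T)) (hh : IsContMDiffFamilyOn ∞ h univ)
      (hR : ∀ r, (h r).IsRiemannian),
      ∀ {t₀ r : ℝ} (ht₀ : t₀ ∈ Icc a T) (hb : t₀ - 0 ∈ Icc a T), a < t₀ → 0 < r →
      t₀ + Tp * r ^ 2 ≤ T → ∀ x₀ : M,
      (∀ s ∈ Icc t₀ (t₀ + Tp * r ^ 2), ∀ y : M,
        (h t₀).edist (hR t₀) x₀ y < ENNReal.ofReal (A' * r) →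
        ∀ v : TangentSpace 𝓘(ℝ, EuclideanSpace ℝ (Fin m)) y,
          |(cov s).ricci y v v| ≤ K / r ^ 2 * (h s).val y v v) →
      ∀ {t : ℝ} (ht : t ∈ Icc a T) (x : M),
      (⟨⟨t, ht⟩, x⟩ : (ricciFlowMetricFlow hh hR Set.ordConnected_Icc hflow).Pt) ∈
        (ricciFlowMetricFlow hh hR Set.ordConnected_Icc hflow).pParabolicNhd ⟨⟨t₀, ht₀⟩, x₀⟩
          (A * r) 0 (Tp * r ^ 2) hb →
      (h t₀).edist (hR t₀) x₀ x < ENNReal.ofReal (A' * r) := by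
  classical
  -- the constants
  obtain ⟨C, hC, hsharpC⟩ := exists_wassersteinW1_condKernel_dirac_le_of_rough m hm hK hTp
  obtain ⟨C₀, hC₀, hsmallC⟩ := exists_edist_hCenter_le_of_global_ricci_bound m hm
  set H : ℝ := MetricFlow.concentrationConst m with hHdef
  have hH0 : 0 ≤ H := by
    have h3 : (3 : ℝ) ≤ m := by exact_mod_cast hm
    have h1 : 0 ≤ ((m : ℝ) - 1) * Real.pi ^ 2 / 2 :=
      div_nonneg (mul_nonneg (by linarith only [h3]) (sq_nonneg _)) zero_le_two
    rw [hHdef, MetricFlow.concentrationConst]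
    linarith only [h1]
  set P : ℝ := Real.sqrt (H * Tp) with hP
  set L : ℝ := Real.exp (K * Tp) with hL
  have hP0 : 0 ≤ P := Real.sqrt_nonneg _
  have hL0 : 0 < L := Real.exp_pos _
  set D : ℝ := A + P + C + L * (2 * P + Real.sqrt H + C₀) with hD
  have hD0 : 0 ≤ D := by positivity
  set A' : ℝ := 2 * D + 2 * (L * Real.sqrt Tp) + 1 with hA'
  have hLT : 0 ≤ L * Real.sqrt Tp := by positivity
  have hA'0 : 0 < A' := by rw [hA']; linarith only [hD0, hLT]
  have hc1 : L * Real.sqrt Tp < A' / 2 := by rw [hA']; linarith only [hD0, hLT]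
  have hc4 : A + P + C + L * (2 * P + Real.sqrt H + C₀) ≤ A' / 2 := by
    rw [hA', ← hD]; linarith only [hD0, hLT]
  refine ⟨A', hA'0, ?_⟩
  intro M _ _ _ _ _ _ _ _ _ h cov a T hflow hh hR t₀ r ht₀ hb hat₀ hr hTT x₀ hRic t ht x hmem
  -- a qualitative global Ricci bound of the compact smooth flow
  obtain ⟨K₀, hK₀⟩ := hflow.smooth.exists_curvatureBoundedBy_of_isCompact hflow.isLeviCivita
    isCompact_Icc (subset_refl _) (fun r _ ↦ hR r)
  set Kg : ℝ := (Module.finrank ℝ (EuclideanSpace ℝ (Fin m)) : ℝ) * max K₀ 0 + 1 with hKg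
  have hKg0 : 0 < Kg := by positivity
  have hRicg : ∀ τ ∈ Icc a T, ∀ (y : M) (v : TangentSpace 𝓘(ℝ, EuclideanSpace ℝ (Fin m)) y),
      |(cov τ).ricci y v v| ≤ Kg * (h τ).val y v v := by
    intro τ hτ y v
    have h1 := ((hK₀ τ hτ).mono (le_max_left K₀ 0)).abs_ricci_le (hR τ) y v
    have hval : 0 ≤ (h τ).val y v v := by
      by_cases hv : v = 0
      · subst hv; simp
      · exact (hR τ y v hv).le
    exact h1.trans (mul_le_mul_of_nonneg_right (by rw [hKg]; linarith only) hval)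
  -- the step size `δ = min (r², 1/K_g)`
  have hr2 : 0 < r ^ 2 := pow_pos hr 2
  set δ : ℝ := min (r ^ 2) (1 / Kg) with hδ
  have hδ0 : 0 < δ := lt_min hr2 (by positivity)
  have hδr : δ ≤ r ^ 2 := min_le_left _ _
  have hδK : Kg * δ ≤ 1 :=
    calc Kg * δ ≤ Kg * (1 / Kg) := mul_le_mul_of_nonneg_left (min_le_right _ _) hKg0.le
      _ = 1 := mul_one_div_cancel hKg0.ne'
  -- the metric flow; the membership unfolded at the base time `t₀ = t₀ − 0`
  let X : MetricFlow (Icc a T) := ricciFlowMetricFlow hh hR Set.ordConnected_Icc hflow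
  have hm0 : 0 < m := by omega
  have hHc : X.IsHConcentrated H := ricciFlowMetricFlow_isHConcentrated hm0 hh hR _ hflow
  obtain ⟨⟨h0t, htT⟩, hℓ⟩ := (MetricFlow.mem_pParabolicNhd_iff_of_coe_eq hb (s₀ := ⟨t₀, ht₀⟩)
    (show t₀ = t₀ - 0 from (sub_zero t₀).symm)).1 hmem
  have h0t : t₀ ≤ t := h0t
  have htT : t ≤ t₀ + Tp * r ^ 2 := htT
  have hℓ : wassersteinW1 (X.condKernel (t := ⟨t₀, ht₀⟩) x₀ ⟨t₀, ht₀⟩)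
      (X.condKernel (t := ⟨t, ht⟩) x ⟨t₀, ht₀⟩) < ENNReal.ofReal (A * r) := hℓ
  /- the bootstrap: every `H_m`-centre `z` of `(x, t)` at every time `s ∈ [t₀, t]` is rough -/
  have key : ∀ (k : ℕ) (s : ℝ) (hs : s ∈ Icc a T), t₀ ≤ s → s ≤ t → s ≤ t₀ + k * δ → ∀ z : M,
      X.IsHCenter H (s := ⟨s, hs⟩) (t := ⟨t, ht⟩) z x →
      (h t₀).edist (hR t₀) x₀ z < ENNReal.ofReal (A' / 2 * r) := by
    intro k
    induction k with
    | zero =>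
      intro s hs h0s hst hsk z hz
      have hst₀ : t₀ = s := le_antisymm h0s (by simpa using hsk)
      subst hst₀
      haveI := X.isProbabilityMeasure_condKernel (s := ⟨t₀, ht₀⟩) (t := ⟨t, ht⟩) x h0t
      have hself : X.condKernel (t := ⟨t₀, ht₀⟩) x₀ ⟨t₀, ht₀⟩ =
          (Measure.dirac x₀ : Measure (X.Slice ⟨t₀, ht₀⟩)) := X.condKernel_self x₀
      have hzW : wassersteinW1 (X.condKernel (t := ⟨t, ht⟩) x ⟨t₀, ht₀⟩)
          (Measure.dirac (show X.Slice ⟨t₀, ht₀⟩ from z)) ≤ ENNReal.ofReal (P * r) := by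
        rw [wassersteinW1_comm]
        exact hz.wassersteinW1_dirac_le.trans (ofReal_mul_rpow_half_le_ofReal_sqrt_mul hH0
          (sub_nonneg.2 h0t) hr.le (by linarith only [htT]))
      show edist (show X.Slice ⟨t₀, ht₀⟩ from x₀) (show X.Slice ⟨t₀, ht₀⟩ from z) < _
      rw [← wassersteinW1_dirac_dirac]
      calc wassersteinW1 (Measure.dirac (show X.Slice ⟨t₀, ht₀⟩ from x₀))
            (Measure.dirac (show X.Slice ⟨t₀, ht₀⟩ from z))
          ≤ wassersteinW1 (Measure.dirac (show X.Slice ⟨t₀, ht₀⟩ from x₀))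
                (X.condKernel (t := ⟨t, ht⟩) x ⟨t₀, ht₀⟩) +
              wassersteinW1 (X.condKernel (t := ⟨t, ht⟩) x ⟨t₀, ht₀⟩)
                (Measure.dirac (show X.Slice ⟨t₀, ht₀⟩ from z)) := wassersteinW1_triangle _ _ _
        _ < ENNReal.ofReal (A * r) + ENNReal.ofReal (P * r) :=
            ENNReal.add_lt_add_of_lt_of_le (ne_top_of_le_ne_top ENNReal.ofReal_ne_top hzW)
              (by rw [← hself]; exact hℓ) hzW
        _ = ENNReal.ofReal ((A + P) * r) := by
            rw [← ENNReal.ofReal_add (by positivity) (by positivity)]; ring_nf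
        _ ≤ ENNReal.ofReal (A' / 2 * r) := by
            refine ENNReal.ofReal_le_ofReal (mul_le_mul_of_nonneg_right ?_ hr.le)
            have : 0 ≤ C + L * (2 * P + Real.sqrt H + C₀) := by positivity
            linarith only [hc4, this]
    | succ k ih =>
      intro s hs h0s hst hsk z hz
      by_cases hcase : s ≤ t₀ + k * δ
      · exact ih s hs h0s hst hcase z hz
      rw [not_le] at hcase
      push_cast at hsk
      have hkδ : 0 ≤ (k : ℝ) * δ := by positivity
      -- the previous time `s′ = max t₀ (s − δ)` and an `H_m`-centre `z′` of `(x, t)` there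
      set s' : ℝ := max t₀ (s - δ) with hs'def
      have h0s' : t₀ ≤ s' := le_max_left _ _
      have hs's : s' ≤ s := max_le h0s (by linarith only [hδ0])
      have hs'lt : s' < s := max_lt (by linarith only [hcase, hkδ]) (by linarith only [hδ0])
      have hss' : s - s' ≤ δ := by
        have := le_max_right t₀ (s - δ)
        linarith only [this]
      have hs'k : s' ≤ t₀ + k * δ := max_le (by linarith only [hkδ]) (by linarith only [hsk])
      have hs'mem : s' ∈ Icc a T := ⟨ht₀.1.trans h0s', hs's.trans hs.2⟩
      have hs't : s' ≤ t := hs's.trans hst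
      obtain ⟨z', hz'⟩ := hHc.exists_isHCenter (s := ⟨s', hs'mem⟩) (t := ⟨t, ht⟩) hs't x
      -- `z′` is rough (induction), hence sharply localised (Prop. 9.5)
      have hrough' := ih s' hs'mem h0s' hs't hs'k z' hz'
      have hsharp' := hsharpC hflow hh hR ht₀ hat₀ hr hTT hc1 x₀ hRic hs'mem h0s'
        (hs't.trans htT) z' hrough'
      -- the `H_m`-centres of `(z, s)` at `s′` are `C₀ r`-close to `z` (global curvature scale)
      have hsmall : ∀ w : M, X.IsHCenter H (s := ⟨s', hs'mem⟩) (t := ⟨s, hs⟩) w z →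
          (h s').edist (hR s') z w ≤ ENNReal.ofReal (C₀ * r) := by
        intro w hw
        have hKδ : Kg * (s - s') ≤ 1 := (mul_le_mul_of_nonneg_left hss' hKg0.le).trans hδK
        have h1 := hsmallC hflow hh hR hRicg (hat₀.trans_le h0s') hs'lt hs.2 hKδ z w
          hw.lintegral_edist_sq_le
        have h2 : C₀ * Real.sqrt (s - s') ≤ C₀ * r := by
          refine mul_le_mul_of_nonneg_left ?_ hC₀.le
          calc Real.sqrt (s - s') ≤ Real.sqrt (r ^ 2) := Real.sqrt_le_sqrt (hss'.trans hδr)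
            _ = r := Real.sqrt_sq hr.le
        exact (ENNReal.le_ofReal_iff_toReal_le (PseudoRiemannianMetric.edist_ne_top (hR s') z w)
          (by positivity)).2 (h1.trans h2)
      -- the bootstrap step
      exact edist_lt_of_isHCenter_of_isHCenter hflow hh hR hm hK hTp.le hC.le hC₀.le hr hc4 ht₀ ht
        hs'mem hs h0s' hs's hst htT hTT (hss'.trans hδr) x₀ hRic x hℓ hz' hz hsharp' hsmall
  /- conclusion: `x` is an `H_m`-centre of `(x, t)` at time `t` -/
  obtain ⟨k, hk⟩ := exists_nat_ge ((t - t₀) / δ)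
  have htk : t ≤ t₀ + k * δ := by
    rw [div_le_iff₀ hδ0] at hk
    linarith only [hk]
  have hfin := key k t ht h0t le_rfl htk x (X.isHCenter_self H x)
  exact hfin.trans_le (ENNReal.ofReal_le_ofReal (by nlinarith only [hA'0, hr]))

end Literature.Geometry.Riemannian

end
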